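import Mathlib
import Summits.RiemannHypothesis.RiemannHypothesis.Theorems.JensenPolynomialsDefs
import Summits.RiemannHypothesis.RiemannHypothesis.Theses.JensenPolynomials
import Summits.RiemannHypothesis.RiemannHypothesis.Theorems.JensenSignTestBlueprint
import Summits.RiemannHypothesis.RiemannHypothesis.Theorems.JensenHermiteExpansion
import Literature.NumberTheory.LFunctions.XiMoments

/-!
# The POINTWISE blueprint on the analytic regime (theory g7 prep; the proof of the proposed support item
`SignTestOfCoeffSmallFrom` of route `JensenPolynomials` — RH-FREE, ξ-free glue)

`XiDeltaSqPos → HermiteCriticalRatioBound rhoWinMin → XiGorttwCoeffSmallFrom rhoWinMin 10⁴ →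
 ∀ d n, 3 ≤ d → 2d³ ≤ n → 10⁴ ≤ n → HermiteSignTest xiTaylorCoeff d n`:
the proof of `hermiteSignTestCubic_of_laws` (Theorems/JensenSignTestBlueprint.lean) run at ONE pair (d, n), with the
coefficient-smallness hypothesis taken from the analytic regime only. Nothing here bears on the truth of RH.
-/

noncomputable section
-- D-0017: `Summit.RiemannHypothesis.RiemannHypothesis.…` duplicates the namespace BY DESIGN (single-problem summit).
set_option linter.dupNamespace false

open Polynomial Finset

namespace Summit.RiemannHypothesis.RiemannHypothesis.Theorems.JensenPolynomials

open Literature.NumberTheory.LFunctions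

/-- **Pointwise blueprint (any table `ρ`, any shift threshold `N`)**: strict Turán positivity, a Hermite critical-ratio
table and coefficient smallness on the regime `n ≥ N` give the Hermite sign test at every `(d, n)` of that regime. -/
theorem hermiteSignTest_of_coeffSmallFrom (hΔ : XiDeltaSqPos) {ρ : ℕ → ℕ → ℝ} {N : ℕ}
    (hH : HermiteCriticalRatioBound ρ) (hC : XiGorttwCoeffSmallFrom ρ N) {d n : ℕ} (hd : 3 ≤ d)
    (hdn : 2 * d ^ 3 ≤ n) (hn : N ≤ n) : HermiteSignTest xiTaylorCoeff d n := by
  have hM : xiTaylorCoeff (n + d) ≠ 0 := (xiTaylorCoeff_pos_holds (n + d)).ne'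
  have hM1 : xiTaylorCoeff (n + d - 1) ≠ 0 := (xiTaylorCoeff_pos_holds (n + d - 1)).ne'
  obtain ⟨h0, -, -, hexp⟩ :=
    gorttwFrame_holds xiTaylorCoeff d n (by omega) (hΔ (n + d) (by omega)) hM hM1
  obtain ⟨hC1, hC2⟩ := hC d n hd hdn hn
  refine hermiteSignTest_of_expansion _ hexp h0 ?_ hC2
  intro y hy
  obtain ⟨m, rfl⟩ : ∃ m, d = m + 2 := ⟨d - 2, by omega⟩
  have hne : (gorzHermite (m + 2)).eval y ≠ 0 :=
    gorzHermite_eval_ne_zero_of_critical m (by simpa using hy)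
  have hHpos : 0 < |(gorzHermite (m + 2)).eval y| := abs_pos.2 hne
  calc ∑ j ∈ range (m + 2), |gorttwCoeff xiTaylorCoeff (m + 2) n (j + 1)| *
          |(gorzHermite (m + 2 - (j + 1))).eval y|
      ≤ ∑ j ∈ range (m + 2), |gorttwCoeff xiTaylorCoeff (m + 2) n (j + 1)| *
          (ρ (m + 2) (j + 1) * |(gorzHermite (m + 2)).eval y|) := by
        refine sum_le_sum fun j hj => ?_
        rw [mem_range] at hj
        exact mul_le_mul_of_nonneg_left (hH (m + 2) (j + 1) y (by omega) (by omega) hy) (abs_nonneg _)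
    _ = (∑ j ∈ range (m + 2), |gorttwCoeff xiTaylorCoeff (m + 2) n (j + 1)| * ρ (m + 2) (j + 1)) *
          |(gorzHermite (m + 2)).eval y| := by
        rw [sum_mul]; exact sum_congr rfl fun j _ => by ring
    _ < |(gorzHermite (m + 2)).eval y| := by
        have := mul_lt_mul_of_pos_right hC1 hHpos
        simpa using this

/-- The proposed route support item, PROVED (statement literally as in the re-glue sketch:
`XiDeltaSqPos → HermiteCriticalRatioWindow → XiGorttwCoeffSmallAnalytic → ∀ d n, 3 ≤ d → 2d³ ≤ n → 10⁴ ≤ n →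
HermiteSignTest xiTaylorCoeff d n`, over the Theses item names). -/
theorem signTestOfCoeffSmallFrom_statement :
    Summit.RiemannHypothesis.RiemannHypothesis.Theses.JensenPolynomials.XiDeltaSqPos →
    Summit.RiemannHypothesis.RiemannHypothesis.Theses.JensenPolynomials.HermiteCriticalRatioWindow →
    Summit.RiemannHypothesis.RiemannHypothesis.Theses.JensenPolynomials.XiGorttwCoeffSmallAnalytic →
      ∀ d n : ℕ, 3 ≤ d → 2 * d ^ 3 ≤ n → 10000 ≤ n → HermiteSignTest xiTaylorCoeff d n :=
  fun hΔ hH hC _ _ hd hdn hn => hermiteSignTest_of_coeffSmallFrom hΔ hH hC hd hdn hn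

/-- The route item `SignTestOfCoeffSmallFrom` (stmt-RiemannHypothesis-19412) stated BY NAME, so the gate matches it:
the pointwise sign-test blueprint on the analytic regime `n ≥ 10⁴`. RH-FREE. -/
theorem signTestOfCoeffSmallFrom_item :
    Summit.RiemannHypothesis.RiemannHypothesis.Theses.JensenPolynomials.SignTestOfCoeffSmallFrom :=
  fun hΔ hH hC _ _ hd hdn hn => hermiteSignTest_of_coeffSmallFrom hΔ hH hC hd hdn hn

end Summit.RiemannHypothesis.RiemannHypothesis.Theorems.JensenPolynomials

end
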